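import Mathlib.Analysis.InnerProductSpace.Projection.Basic
import Mathlib.Analysis.InnerProductSpace.GramMatrix
import Mathlib.Topology.Algebra.Module.FiniteDimension
import HarnessLib

/-!
# The product-free (Gram-pencil) bound for a finite-rank operator `u ↦ ∑ᵢ (N x)ᵢ vᵢ`, `xⱼ = ⟪aⱼ, u⟫`

`Literature/Analysis/OperatorTheory`, sequel of `FiniteRankGramBound.lean` and `FiniteRankNormBound.lean`
(everything proved; no definitions, no named facts).  Setting: a real inner product space `H`, a finite
family `a : ι → H` with Gram matrix `G = Matrix.gram ℝ a` (`G j i = ⟪a j, a i⟫`, Mathlib), any real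
normed space `E`, a family `v : ι → E` and a matrix `N`.  The finite-rank map

  `T u := ∑ i, (N *ᵥ x(u)) i • v i`,     `x(u) j := ⟪a j, u⟫`,

is the correction term of every Sherman–Morrison–Woodbury / capacitance inverse
(`FiniteRankCapacitance.capInverse`).  `FiniteRankNormBound.norm_finiteRank_mulVec_le` bounds `‖T‖` by a
PRODUCT `γ ν γ'` of three separately certified constants.  This file proves the sharper **product-free
bound**: the coefficient vector `x(u)` always lies in the range of `G` with a preimage of controlled
Gram energy,

  `x(u) = G *ᵥ y`  with  `yᵀ G y ≤ ‖u‖²`                         (`exists_gram_mulVec_eq_inner`)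

(orthogonal projection of `u` onto `span (range a)`: `yᵀ G y = ‖P u‖²` is the Gram identity
`‖∑ yᵢ aᵢ‖² = yᵀ G y`, Mathlib's `Matrix.star_dotProduct_gram_mulVec`), hence any quadratic bound on the
PENCIL `(Q(G ·), G)`,

  `Q(G y) ≤ Λ · yᵀ G y` for all `y`   ⟹   `Q(x(u)) ≤ Λ ‖u‖²`        (`le_of_gram_pencil`),

in particular `‖T u‖² ≤ Λ ‖u‖²` as soon as `‖∑ (N G y)ᵢ vᵢ‖² ≤ Λ yᵀ G y` for all `y`
(`norm_sum_mulVec_smul_sq_le_of_gram_pencil`, `norm_sum_mulVec_smul_le_of_gram_pencil`).  When `E` is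
also an inner product space the left side is `yᵀ G Nᵀ G_v N G y` and `Λ` is the top generalized
eigenvalue of the symmetric pencil `(G Nᵀ G_v N G, G)` — equivalently `λ_max(G · NᵀG_vN)` — with no
product of norms taken; a factorised sufficient condition (`G = L Lᵀ`, `Lᵀ A L ≤ Λ`) is
`gram_pencil_of_factor`.

Sources.  The Gram identity and the range/kernel structure of Gram matrices: R. A. Horn, C. R. Johnson,
*Matrix Analysis*, 2nd ed. (CUP 2013) [HornJohnson2013], §7.2 (Thm. 7.2.10: `G = B*B`, `rank G = rank B`,
so `x(u) = B* u ∈ range G`); the operator-norm reading ("the norm of a finite-rank operator is the top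
singular value of its Gram-weighted coefficient matrix") is T. Kato, *Perturbation Theory for Linear
Operators* (1966) [Kato1966], I-§6.3 / V-§2.1.  The pencil formulation is the form in which validated
numerics certifies it (a Cholesky test of `Λ G − G A G ⪰ 0`).

MOTIVATION (recorded for provenance): the `K_N` constants of the sheet-ℝ certificate chain of cell
ns-blowup, case Z3-SR-CERT (`HOME/profile/cert/impl1/SHEET-R-PRICE-impl1.md` §2 (C2):
"`‖DG_N⁻¹‖ ≤ 2/c_λ + λ_max(G_w(z)·C⁻ᵀG_E(v)C⁻¹)^{1/2}/(2L³π)` … product-free formula = the exact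
finite-rank norm; only the triangle inequality loses: 5.57 vs 3.99").  WHAT THIS IS NOT: nothing about
Navier–Stokes; finite-dimensional Hilbert-space algebra.
-/

noncomputable section

open Matrix Finset
open scoped BigOperators

namespace Literature.Analysis.OperatorTheory

variable {H : Type*} [NormedAddCommGroup H] [InnerProductSpace ℝ H]
variable {E : Type*} [NormedAddCommGroup E] [NormedSpace ℝ E]
variable {ι : Type*} [Fintype ι]

/-- The Gram identity in `mulVec` form: `yᵀ G y = ‖∑ᵢ yᵢ aᵢ‖²` for `G = Matrix.gram ℝ a`.
[cite: HornJohnson2013, §7.2, Thm. 7.2.10 (Gram matrices `G = B*B`)] -/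
theorem dotProduct_gram_mulVec_eq_norm_sq (a : ι → H) (y : ι → ℝ) :
    y ⬝ᵥ (Matrix.gram ℝ a *ᵥ y) = ‖∑ i, y i • a i‖ ^ 2 := by
  have h := Matrix.star_dotProduct_gram_mulVec (𝕜 := ℝ) a y y
  rw [star_trivial] at h
  rw [h, real_inner_self_eq_norm_sq]

/-- The coefficient vector against a combination: `⟪a j, ∑ᵢ yᵢ aᵢ⟫ = (G *ᵥ y) j`.
[cite: HornJohnson2013, §7.2, Thm. 7.2.10 (Gram matrices `G = B*B`)] -/
theorem inner_sum_smul_eq_gram_mulVec (a : ι → H) (y : ι → ℝ) (j : ι) :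
    inner ℝ (a j) (∑ i, y i • a i) = (Matrix.gram ℝ a *ᵥ y) j := by
  rw [inner_sum, Matrix.mulVec, dotProduct]
  refine Finset.sum_congr rfl fun i _ => ?_
  rw [real_inner_smul_right, Matrix.gram_apply, mul_comm]

/-- **Range lemma.** For every `u : H` the coefficient vector `x j = ⟪a j, u⟫` is of the form `G *ᵥ y`
with `yᵀ G y ≤ ‖u‖²` (`y` = coordinates of the orthogonal projection of `u` onto `span (range a)`,
`yᵀ G y = ‖P u‖²`; Horn–Johnson: `x = B* u ∈ range B* = range G`).
[cite: HornJohnson2013, §7.2, Thm. 7.2.10 (Gram matrices, `rank G = rank B`)] -/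
theorem exists_gram_mulVec_eq_inner (a : ι → H) (u : H) :
    ∃ y : ι → ℝ, (Matrix.gram ℝ a *ᵥ y = fun j => inner ℝ (a j) u) ∧
      y ⬝ᵥ (Matrix.gram ℝ a *ᵥ y) ≤ ‖u‖ ^ 2 := by
  set K : Submodule ℝ H := Submodule.span ℝ (Set.range a) with hK
  haveI : FiniteDimensional ℝ K := FiniteDimensional.span_of_finite ℝ (Set.finite_range a)
  haveI : CompleteSpace K := FiniteDimensional.complete ℝ K
  obtain ⟨w, hwK, hw⟩ := Submodule.HasOrthogonalProjection.exists_orthogonal (K := K) u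
  obtain ⟨y, hy⟩ := (Submodule.mem_span_range_iff_exists_fun ℝ).1 hwK
  refine ⟨y, ?_, ?_⟩
  · funext j
    have haj : a j ∈ K := Submodule.subset_span (Set.mem_range_self j)
    have h0 : inner ℝ (a j) (u - w) = 0 := Submodule.inner_right_of_mem_orthogonal haj hw
    rw [← inner_sum_smul_eq_gram_mulVec, hy]
    rw [inner_sub_right, sub_eq_zero] at h0
    exact h0.symm
  · rw [dotProduct_gram_mulVec_eq_norm_sq, hy]
    -- `‖w‖² ≤ ‖u‖²` by Pythagoras: `u = w + (u - w)`, `w ⊥ u - w`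
    have horth : inner ℝ w (u - w) = 0 := Submodule.inner_right_of_mem_orthogonal hwK hw
    have hpy : ‖w + (u - w)‖ * ‖w + (u - w)‖ = ‖w‖ * ‖w‖ + ‖u - w‖ * ‖u - w‖ :=
      norm_add_sq_eq_norm_sq_add_norm_sq_of_inner_eq_zero _ _ horth
    rw [add_sub_cancel] at hpy
    nlinarith [norm_nonneg (u - w), norm_nonneg w, norm_nonneg u]

/-- **Pencil bound ⇒ bound on the coefficient functional.** If a real function `Q` on coefficient
vectors satisfies `Q (G *ᵥ y) ≤ Λ · yᵀ G y` for all `y` (with `Λ ≥ 0` and `Q` arbitrary), then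
`Q (⟪a ·, u⟫) ≤ Λ ‖u‖²` for every `u`.  (`Λ` = top of the pencil `(Q ∘ G, G)`; no product of norms.)
[cite: Kato1966, I-§6.3 (extremal characterisation of the largest eigenvalue of a symmetric pencil)] -/
theorem le_of_gram_pencil (a : ι → H) (Q : (ι → ℝ) → ℝ) {Λ : ℝ} (hΛ : 0 ≤ Λ)
    (hQ : ∀ y : ι → ℝ, Q (Matrix.gram ℝ a *ᵥ y) ≤ Λ * (y ⬝ᵥ (Matrix.gram ℝ a *ᵥ y))) (u : H) :
    Q (fun j => inner ℝ (a j) u) ≤ Λ * ‖u‖ ^ 2 := by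
  obtain ⟨y, hy, hyu⟩ := exists_gram_mulVec_eq_inner a u
  rw [← hy]
  exact (hQ y).trans (mul_le_mul_of_nonneg_left hyu hΛ)

/-- **Product-free norm bound for the finite-rank correction** (squared form).  If
`‖∑ᵢ (N G y)ᵢ vᵢ‖² ≤ Λ · yᵀ G y` for all `y`, then `‖∑ᵢ (N x)ᵢ vᵢ‖² ≤ Λ ‖u‖²` for `x j = ⟪a j, u⟫`.
[cite: Kato1966, I-§6.3 (norm of a finite-rank operator via its Gram-weighted matrix)] -/
theorem norm_sum_mulVec_smul_sq_le_of_gram_pencil (a : ι → H) (v : ι → E) (N : Matrix ι ι ℝ)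
    {Λ : ℝ} (hΛ : 0 ≤ Λ)
    (hpencil : ∀ y : ι → ℝ, ‖∑ i, (N *ᵥ (Matrix.gram ℝ a *ᵥ y)) i • v i‖ ^ 2 ≤
      Λ * (y ⬝ᵥ (Matrix.gram ℝ a *ᵥ y)))
    (u : H) (x : ι → ℝ) (hx : ∀ j, x j = inner ℝ (a j) u) :
    ‖∑ i, (N *ᵥ x) i • v i‖ ^ 2 ≤ Λ * ‖u‖ ^ 2 := by
  have hx' : x = fun j => inner ℝ (a j) u := funext hx
  subst hx'
  exact le_of_gram_pencil a (fun x => ‖∑ i, (N *ᵥ x) i • v i‖ ^ 2) hΛ hpencil u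

/-- **Product-free norm bound for the finite-rank correction**: under the pencil hypothesis,
`‖∑ᵢ (N x)ᵢ vᵢ‖ ≤ √Λ ‖u‖` for `x j = ⟪a j, u⟫`.
[cite: Kato1966, I-§6.3 (norm of a finite-rank operator via its Gram-weighted matrix)] -/
theorem norm_sum_mulVec_smul_le_of_gram_pencil (a : ι → H) (v : ι → E) (N : Matrix ι ι ℝ)
    {Λ : ℝ} (hΛ : 0 ≤ Λ)
    (hpencil : ∀ y : ι → ℝ, ‖∑ i, (N *ᵥ (Matrix.gram ℝ a *ᵥ y)) i • v i‖ ^ 2 ≤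
      Λ * (y ⬝ᵥ (Matrix.gram ℝ a *ᵥ y)))
    (u : H) (x : ι → ℝ) (hx : ∀ j, x j = inner ℝ (a j) u) :
    ‖∑ i, (N *ᵥ x) i • v i‖ ≤ Real.sqrt Λ * ‖u‖ := by
  have h := norm_sum_mulVec_smul_sq_le_of_gram_pencil a v N hΛ hpencil u x hx
  have h2 : ‖∑ i, (N *ᵥ x) i • v i‖ ^ 2 ≤ (Real.sqrt Λ * ‖u‖) ^ 2 := by
    rw [mul_pow, Real.sq_sqrt hΛ]
    exact h
  exact (pow_le_pow_iff_left₀ (norm_nonneg _) (by positivity) two_ne_zero).1 h2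

/-- **Factorised sufficient condition for the pencil hypothesis.**  If `G = L * Lᵀ` and the symmetric
compression satisfies `wᵀ (Lᵀ A L) w ≤ Λ wᵀ w` for all `w`, then `(G y)ᵀ A (G y) ≤ Λ yᵀ G y` for all `y`
(congruence).  With `A = Nᵀ G_v N` this is the Cholesky form of the test "`λ_max(G A) ≤ Λ`".
[cite: HornJohnson2013, §7.2, Thm. 7.2.7 (Cholesky factorisation `G = L L*`) with Obs. 7.1.8 (congruence preserves `⪯`)] -/
theorem gram_pencil_of_factor (G A L : Matrix ι ι ℝ) {Λ : ℝ} (hG : G = L * Lᵀ)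
    (hA : ∀ w : ι → ℝ, w ⬝ᵥ ((Lᵀ * A * L) *ᵥ w) ≤ Λ * (w ⬝ᵥ w)) (y : ι → ℝ) :
    (G *ᵥ y) ⬝ᵥ (A *ᵥ (G *ᵥ y)) ≤ Λ * (y ⬝ᵥ (G *ᵥ y)) := by
  set w : ι → ℝ := Lᵀ *ᵥ y with hw
  have h1 : (G *ᵥ y) ⬝ᵥ (A *ᵥ (G *ᵥ y)) = w ⬝ᵥ ((Lᵀ * A * L) *ᵥ w) := by
    rw [hG, ← Matrix.mulVec_mulVec, ← Matrix.mulVec_mulVec, ← hw, ← Matrix.mulVec_mulVec,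
      Matrix.dotProduct_mulVec w Lᵀ (A *ᵥ (L *ᵥ w)), Matrix.vecMul_transpose]
  have h2 : y ⬝ᵥ (G *ᵥ y) = w ⬝ᵥ w := by
    rw [hG, ← Matrix.mulVec_mulVec, ← hw, Matrix.dotProduct_mulVec y L w, ← Matrix.mulVec_transpose,
      ← hw]
  rw [h1, h2]
  exact hA w

end Literature.Analysis.OperatorTheory

end
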